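import Summits.ValiantsHypothesis.ValiantsHypothesis.Theorems.DepthWindowBDSBound
import HarnessLib

/-!
# Route `DepthWindow` — the BDS kernel at slope `7/5` (route-independent part of item `HomImmHardSubReach`)

Helper file of the route `Theses/DepthWindow.lean` (decomp-valiant workshop, lens 4, generation 10; port plan `PLAN-w2`
F5′, cone-free half): the counting step that turns `DepthWindowBDSBound.homBds` into "more than `m^c + c` gates" at
product-depth `≤ ⌊7 v/5⌋ + c` (`v = ⌊log₂⌊log₂ L⌋⌋`, `L = ⌊log₂ m⌋`, `d = ⌊√L⌋`, `λ = 256 (c+2) Δ`), GIVEN the fit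
`2 ≤ Δ`, `λ^{F_{Δ+2}} ≤ √L`, `4√L ≤ L` as a hypothesis on `L` (supplied for all large `L` by `DepthWindowBDSFit.fit`,
which is where `7/5 · log₂ φ < 1` enters).  Kept free of the route file's import cone on purpose: the closing
wrappers (`HomImmHardAt 7 5`, the down-set in the slope, the item) live in `DepthWindowHomImmHardBDS.lean`.

* `homBds_core` : `(s d^d + 1)^Δ ≥ 2^{L(λ-32)/128} ≥ 2^{(2(c+2)Δ-1)L}` against `(s d^d+1)^Δ ≤ 2^{((L+1)c+c+L+1)Δ}` for
  `s ≤ m^c + c` — absurd for `Δ ≥ 2`, `L ≥ 4`.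

Unconditional, 0 sorry, def-free; rung currency only — nothing here bears on `VP ≠ VNP` itself.

References: [BhargavDuttaSaxena2024] Thm 1.4, §4.1, Lemma 4.3.
-/

-- layout Summits/ValiantsHypothesis/ValiantsHypothesis forces the duplicated namespace component
set_option linter.dupNamespace false

namespace Summit.ValiantsHypothesis.ValiantsHypothesis.Theorems.DepthWindow

open MvPolynomial Literature.Computability.AlgebraicComplexity ArithCircuit

noncomputable section

/-- **The kernel of `homImmHardAt_seven_five`**, with `d = ⌊√L⌋` and `L = ⌊log₂ m⌋` as named parameters (so that the
circuit's index type does not depend on them through `m`): past the fit threshold of `BDS.fit c`, a homogeneous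
circuit of product-depth `≤ ⌊7⌊log₂⌊log₂ L⌋⌋/5⌋ + c` computing `IMM_{m,d}` over `ℂ` has more than `m^c + c` gates.
[cite: BhargavDuttaSaxena2024, Thm 1.4] -/
theorem homBds_core (c : ℕ) {L₀ : ℕ}
    (hL₀ : ∀ L : ℕ, L₀ ≤ L → 2 ≤ 7 * Nat.log 2 (Nat.log 2 L) / 5 + c ∧
      (256 * (c + 2) * (7 * Nat.log 2 (Nat.log 2 L) / 5 + c)) ^
          Nat.fib (7 * Nat.log 2 (Nat.log 2 L) / 5 + c + 2) ≤ Nat.sqrt L ∧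
      4 * Nat.sqrt L ≤ L)
    (m : ℕ) (hm : 2 ^ L₀ ≤ m) {d L : ℕ} (hL : L = Nat.log 2 m) (hd : d = Nat.sqrt L)
    (D : ArithCircuit ℂ (Fin d × Fin m × Fin m))
    (hhom : ∀ v ∈ ArithCircuit.gateValues D.gates, ∃ e : ℕ, v.IsHomogeneous e)
    (hD : D.Computes (immPoly m d ℂ)) (hpd : D.productDepth ≤ 7 * Nat.log 2 (Nat.log 2 L) / 5 + c) :
    m ^ c + c < D.size := by
  have hLge : L₀ ≤ L := by rw [hL]; exact Nat.le_log_of_pow_le (by norm_num) hm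
  obtain ⟨hΔ2, hfitN, h4d⟩ := hL₀ L hLge
  set Δ := 7 * Nat.log 2 (Nat.log 2 L) / 5 + c with hΔ
  set lam := 256 * (c + 2) * Δ with hlam
  have hlam32 : 32 ≤ lam := by rw [hlam]; nlinarith
  have hdd : d * d ≤ L := by rw [hd]; exact Nat.sqrt_le L
  have hd4 : 4 * d ≤ L := by rw [hd]; exact h4d
  have hd1 : 1 ≤ d := by
    have h1 : 1 ≤ lam ^ Nat.fib (Δ + 2) := Nat.one_le_pow _ _ (by omega)
    rw [hd]; omega
  have hL4 : 4 ≤ L := by omega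
  have hfit : lam ^ Nat.fib (Δ + 2) ≤ lam * d := by
    calc lam ^ Nat.fib (Δ + 2) ≤ d := by rw [hd]; exact hfitN
      _ ≤ lam * d := Nat.le_mul_of_pos_left d (by omega)
  have hdn : 4 * d ≤ Nat.log 2 m := hL ▸ hd4
  have h := BDS.homBds ℂ (Δ := Δ) (by omega) m d lam hd1 hlam32 hfit hdn D hpd hhom hD
  rw [← hL] at h
  -- an integer lower bound for the exponent: `(2(c+2)Δ - 1) L ≤ L (λ - 32)/128`
  have hE1 : 1 ≤ 2 * (c + 2) * Δ := by nlinarith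
  have hexp : ((((2 * (c + 2) * Δ - 1) * L : ℕ)) : ℝ) ≤ (L : ℝ) * ((lam : ℝ) - 32) / 128 := by
    have hlamR : (lam : ℝ) = 256 * ((c : ℝ) + 2) * Δ := by rw [hlam]; push_cast; ring
    have hLR : (0 : ℝ) ≤ L := Nat.cast_nonneg _
    push_cast [Nat.cast_sub hE1]
    rw [hlamR]
    nlinarith [hLR]
  have hN : 2 ^ ((2 * (c + 2) * Δ - 1) * L) ≤ (D.size * d ^ d + 1) ^ Δ := by
    have h1 := (Real.rpow_le_rpow_of_exponent_le one_le_two hexp).trans h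
    rw [Real.rpow_natCast] at h1
    exact_mod_cast h1
  -- suppose the circuit were small
  by_contra hs
  push Not at hs
  have hm2 : m < 2 ^ (L + 1) := by rw [hL]; exact Nat.lt_pow_succ_log_self one_lt_two m
  have hmc : m ^ c ≤ 2 ^ ((L + 1) * c) := by
    rw [pow_mul]; exact Nat.pow_le_pow_left hm2.le c
  have hmcc : m ^ c + c ≤ 2 ^ ((L + 1) * c + c) := by
    have h1 : c + 1 ≤ 2 ^ c := Nat.lt_two_pow_self
    have h2 : 1 ≤ 2 ^ ((L + 1) * c) := Nat.one_le_two_pow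
    calc m ^ c + c ≤ 2 ^ ((L + 1) * c) + 2 ^ ((L + 1) * c) * c := by nlinarith
      _ = 2 ^ ((L + 1) * c) * (c + 1) := by ring
      _ ≤ 2 ^ ((L + 1) * c) * 2 ^ c := Nat.mul_le_mul_left _ h1
      _ = 2 ^ ((L + 1) * c + c) := by rw [← pow_add]
  have hddL : d ^ d ≤ 2 ^ L := by
    calc d ^ d ≤ (2 ^ d) ^ d := Nat.pow_le_pow_left (Nat.lt_two_pow_self).le d
      _ = 2 ^ (d * d) := by rw [← pow_mul]
      _ ≤ 2 ^ L := Nat.pow_le_pow_right (by norm_num) hdd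
  have hup : D.size * d ^ d + 1 ≤ 2 ^ ((L + 1) * c + c + L + 1) := by
    have h1 : D.size * d ^ d ≤ 2 ^ ((L + 1) * c + c + L) := by
      rw [pow_add]; exact Nat.mul_le_mul (hs.trans hmcc) hddL
    have h2 : 1 ≤ 2 ^ ((L + 1) * c + c + L) := Nat.one_le_two_pow
    rw [pow_succ]; omega
  have hupΔ : (D.size * d ^ d + 1) ^ Δ ≤ 2 ^ (((L + 1) * c + c + L + 1) * Δ) := by
    rw [pow_mul]; exact Nat.pow_le_pow_left hup Δ
  have hfin := (Nat.pow_le_pow_iff_right (by norm_num)).1 (hN.trans hupΔ)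
  -- `(2(c+2)Δ - 1) L ≤ ((L+1)c + c + L + 1) Δ` is absurd for `Δ ≥ 2`, `L ≥ 4`
  zify [hE1] at hfin
  have hcZ : (0 : ℤ) ≤ c := by exact_mod_cast Nat.zero_le c
  have hΔZ : (2 : ℤ) ≤ Δ := by exact_mod_cast hΔ2
  have hLZ : (4 : ℤ) ≤ L := by exact_mod_cast hL4
  nlinarith [mul_nonneg (mul_nonneg hcZ (by linarith : (0 : ℤ) ≤ Δ)) (by linarith : (0 : ℤ) ≤ (L : ℤ) - 2),
    mul_nonneg (by linarith : (0 : ℤ) ≤ (Δ : ℤ) - 2) (by linarith : (0 : ℤ) ≤ 3 * (L : ℤ) - 1)]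

end

end Summit.ValiantsHypothesis.ValiantsHypothesis.Theorems.DepthWindow
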